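import Summits.SmoothPoincare4.SmoothPoincare4.Theses.RootDecompAE

/-!
# RootDecompAE — glue of the rev-3 split «ShadowDoubles» of `ContractibleDoublesStandard`

Proves the glue item `ContractibleDoublesStandardGlue` (stmt-SmoothPoincare4-32184, support, rank 304) of
route-SmoothPoincare4-RootDecompAE rev 3:
`DoublesShadowLEOne → DoublesShadowTwo → DoublesBeyondShadowTwo → ContractibleDoublesStandard`
(stmt-SmoothPoincare4-32181 → 32182 → 32183 → 31477).

Pure logic (two instances of excluded middle on the connected-shadow-complexity cells c* ≤ 1 / c* = 2 / c* ≥ 3 of a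
double `X = C ∪_id C` of a contractible 4-manifold; Koda–Martelli–Naoe grading). Text = the lens's em-form
(HOME/decomp-sp4-lens-1/gen10/split/EDIT.md; tribunal scratch `Trib8.ae_ds_glue`), re-proved against the route's own
declarations. Root decomposition cell decomp-sp4 (D-0178); 0 sorry. Nothing here proves `SmoothPoincare4`.
-/

set_option linter.dupNamespace false

namespace Summit.SmoothPoincare4.SmoothPoincare4.Theorems.RootDecompAEContractibleDoublesSplit

open Summit.SmoothPoincare4.SmoothPoincare4.Theses.RootDecompAE

/-- Item stmt-SmoothPoincare4-32184: the three shadow-complexity cells re-assemble the parent `ContractibleDoublesStandard`. -/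
theorem contractibleDoublesStandardGlue_holds : ContractibleDoublesStandardGlue := by
  intro h₁ h₂ h₃ C _ _ _ _ _ _ _ bC X _ _ _ _ _ e hD
  refine (Classical.em _).elim (fun hc1 => h₁ C bC X e hD hc1) (fun hc1 => ?_)
  exact (Classical.em _).elim (fun hc2 => h₂ C bC X e hD hc1 hc2) (fun hc2 => h₃ C bC X e hD hc2)

end Summit.SmoothPoincare4.SmoothPoincare4.Theorems.RootDecompAEContractibleDoublesSplit
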